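import Literature.MathematicalPhysics.QuantumFieldTheory.Balaban1983to89.B6ZoneByPartsV1
import Literature.MathematicalPhysics.QuantumFieldTheory.Balaban1983to89.B6Cover236MultiLevelTorusReach
import Literature.MathematicalPhysics.QuantumFieldTheory.Balaban1983to89.B4PartitionUnity22
import HarnessLib

/-!
# `Balaban1983to89.B6Line3CutoffV1` — T. Bałaban, *Propagators and renormalization transformations for lattice gauge theories. II*,
# Commun. Math. Phys. **96** (1984) 223–250 [Balaban1984PropagatorsII], p. 238–239: THE SITE CUT-OFF `χ_□` OF THE DOMAIN CHANGE IN LINE 3 OF (2.92)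
# — a product of one-dimensional `C^∞` plateaus on the fine lattice of the V1 torus, its zone of variation, its sizes, and the column cut `c_L`

statement-level skeleton of published theorems with citation tags; proofs where landed; nothing here is a claim about the Yang–Mills mass gap

PDF held: `paper:balaban1984-cmp96-propagators-rt-ii` (journal page = PDF page + 222): p. 238 [PDF 16] (*"An estimate of the terms with the commutator is
even simpler and gives a factor O(M⁻¹)"*, the cubes `□ ⊂ □̃ ⊂ □̃² ⊂ □̃³`), p. 239 [PDF 17] ((2.92) line 3 `ζ_□(∂P∂* − ∂P_□∂*)h_□`), p. 229 [PDF 7]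
((2.36): *"h_□ ∈ C₀^∞(□̃)"*); [Balaban1983RegularityDecay] §2 p. 577 (*"|∂^ηh_j| ≤ O(M⁻¹), |Δ^ηh_j| ≤ O(M⁻²)"*) for the sizes of product cut-offs.

CITATION HEADER (lean-in-tree rule) — WHAT IS REPRODUCED.  Phase-2 file of the `lit-balaban` typed skeleton (HOME `run/shared/lean/pub/lit-balaban/`),
unit `lit-balaban-r03` (B6 fold owner; r03 gen 22, literature-prover-lit-balaban-r03-g22-0), referee ref-4.  SKELETON rows **B6.Prop2.6** ×
**B6.Eq2.92** × B6.Eq2.36 (cells; decls of record untouched).  This is input (d) of B6-CLOSURE §5 item 16 (the cube bookkeeping of p22's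
`…B6Line3WindowV1.line3_window`: its binders `χ`, `N`, `s₁, s₂, s_b`, `c_L` and the twelve hypotheses `hχ0 … hcL`, `hEL`).  IMPORTS BY NAME, restating
nothing: `…B4PartitionUnity22` (r01: `thetaProf`, `thetaCube`, `D1`, `D2`, `abs_thetaCube_diff_le`, `abs_thetaCube_second_diff_le`, `abs_sub_le_D1`),
`…B6AgreeLapV1Chart` (r03 g19: `DeepS`, `shift_mem_deepS`, `unshift_mem_deepS`), `…B6ScalarFactorsChartV1` (p22: `blkS`), `…B6ZoneByPartsV1` (p22:
`shInv`), `…B6Cover236MultiLevelTorusReach` (p21: `abs_sub_le_of_blkOf_eq`).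

## WHAT THIS FILE CERTIFIES (kernel-checked, 0 sorry, standard axioms; two `def`s `chiR`/`chiS` (the cut-off), `zoneN` (its zone), `cL` (the column
cut) with their API — no `def … : Prop`, no new named fact)

* §1 `chiR ctr M_c p = Π_μ θ((p_μ − ctr_μ)/M_c)` on `ℝ^{d+1}` (r01's `thetaCube` recentred): `0 ≤ χ ≤ 1`, `χ = 1` on the plateau `|p − ctr|_∞ ≤ ¾M_c`,
  `χ = 0` off `|p − ctr|_∞ < ⅞M_c`, axis first/second differences `≤ D₁|η|/M_c`, `≤ D₂η²/M_c²`, the sup-norm Lipschitz bound `(d+1)D₁/M_c`.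
* §2 `chiS ctr M_c x` on the V1 sites (labels `val x_μ`): the support is INSIDE the window with margin `3` (`chiS_deep`), so every lattice step touching
  the support is a genuine label step (no wrap of the global torus): `hχ3`, `hχjump`, and the sizes `hd1`, `hd1'`, `hd2`, `hdb` of `line3_window` with
  the CONSTANTS `s₁ = D₁(θ)`, `s₂ = D₂(θ)`, `s_b = (d+1)D₁(θ)` as soon as the blocks near the support have side `≤ M_c` (`hwin`).
* §3 the zone `zoneN` := blocks containing a site at which `χ` or a neighbouring value of `χ` differs from `1`: `hχN`, `hNχ`, non-emptiness.
* §4 the column cut `cL` := indicator of the plateau: `hcL`, and `hEL` (`ζ∂(c_L·) = ζ∂` for every bond cut-off `ζ` whose bonds have both ends on the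
  plateau).

## HONEST SCOPE / DIVERGENCES

(1) Print does not spell the cut-off of the domain change out (p. 238 *"even simpler"*); the product-of-plateaus shape is [Balaban1983RegularityDecay]
§2's `h_j`, the sizes are r01's generic `abs_prod_diff_le`/`abs_prod_second_diff_le`.  (2) Everything is relative to a window `(t, x₀)` of
`…B6AgreeLapV1Chart` and a centre/scale `(ctr, M_c)` with `x₀_μ + ⅞M_c + 3 ≤ ctr_μ`, `ctr_μ + ⅞M_c + 3 ≤ x₀_μ + N′` — instantiated per cube by the
line-3 closer (`ctr` = chart centre of the central cube, `M_c = 8S/3`).  (3) Integer torus, lattice units; no measure; NOT summit progress.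
-/

open scoped BigOperators
open Finset

namespace Literature.MathematicalPhysics.QuantumFieldTheory.Balaban1983to89.B6Line3CutoffV1

open B4Reflection242 (boxDom)
open B4PartitionUnity22 (thetaProf thetaCube D1 D2 thetaCube_mem_Icc thetaCube_eq_one thetaCube_eq_zero abs_thetaCube_diff_le
  abs_thetaCube_second_diff_le abs_sub_le_D1 contDiff_thetaProf hasCompactSupport_thetaProf thetaProf_nonneg thetaProf_le_one D1_nonneg D2_nonneg)
open B6MultiLevelBoxOperator (N0)
open B6MultiLevelTorusOperator (TDomains)
open B6Geom246MultiLevelBox (bset blkOf toR)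
open B8Ineq192MultiLevelTorus (geomTB geomTB_len)
open B6Ineq2133TwoScaleV1 (onFun onFun_apply)
open B6SectAOperatorsV1 (dE)
open B6Prop26Gluing (mulOp mulOp_apply)
open B6GlobalChartV1 (PV toBox toBox_apply blkV1)
open B6ScalarFactorsChartV1 (blkS blkV1_eq_blkS)
open B6AgreeLapV1Chart (DeepS deepS_mono shift_mem_deepS unshift_mem_deepS)
open B6Prop25TwoScaleCensus (TSIdx)
open B6ZoneByPartsV1 (shInv shInv_tt shInv_ff)
open B6Cover236MultiLevelTorusReach (abs_sub_le_of_blkOf_eq)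

noncomputable section

variable {d : ℕ}

/-! ## §1  The product cut-off on `ℝ^{d+1}` -/

section Real

/-- **THE CUT-OFF `χ` CENTRED AT `ctr` WITH SCALE `M_c`**: `χ(p) = Π_μ θ((p_μ − ctr_μ)/M_c)` with r01's plateau `θ ∈ C₀^∞(]−1,1[)`, `θ = 1` on
`[−¾, ¾]` — [Balaban1983RegularityDecay]'s product shape `h_j(x) = Π_μ h(x_μ)`. [cite: Balaban1983RegularityDecay, §2 p.577; Balaban1984PropagatorsII, p.238] -/
def chiR (ctr : Fin (d + 1) → ℝ) (Mc : ℝ) (p : Fin (d + 1) → ℝ) : ℝ := thetaCube Mc 0 (fun μ => p μ - ctr μ)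

variable (ctr : Fin (d + 1) → ℝ) {Mc : ℝ}

/-- unfolding. [cite: Balaban1983RegularityDecay, §2 p.577] -/
theorem chiR_eq (Mc : ℝ) (p : Fin (d + 1) → ℝ) : chiR ctr Mc p = ∏ μ, thetaProf ((p μ - ctr μ) / Mc) := by
  unfold chiR thetaCube
  refine Finset.prod_congr rfl fun μ _ => ?_
  simp

/-- `0 ≤ χ`. [cite: Balaban1983RegularityDecay, §2 p.577] -/
theorem chiR_nonneg (Mc : ℝ) (p : Fin (d + 1) → ℝ) : 0 ≤ chiR ctr Mc p := (thetaCube_mem_Icc _ _ _).1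

/-- `χ ≤ 1`. [cite: Balaban1983RegularityDecay, §2 p.577] -/
theorem chiR_le_one (Mc : ℝ) (p : Fin (d + 1) → ℝ) : chiR ctr Mc p ≤ 1 := (thetaCube_mem_Icc _ _ _).2

/-- `|χ| ≤ 1`. [cite: Balaban1983RegularityDecay, §2 p.577] -/
theorem abs_chiR_le_one (Mc : ℝ) (p : Fin (d + 1) → ℝ) : |chiR ctr Mc p| ≤ 1 := by
  rw [abs_of_nonneg (chiR_nonneg ctr Mc p)]; exact chiR_le_one ctr Mc p

/-- **THE PLATEAU**: `χ(p) = 1` if `|p_μ − ctr_μ| ≤ ¾M_c` for every `μ`. [cite: Balaban1983RegularityDecay, §2 p.577 («h(x) = 1 for |x| ≤ ⅓» shape)] -/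
theorem chiR_eq_one (hMc : 0 < Mc) {p : Fin (d + 1) → ℝ} (h : ∀ μ, |p μ - ctr μ| ≤ 3 / 4 * Mc) : chiR ctr Mc p = 1 :=
  thetaCube_eq_one hMc fun μ => by simpa using h μ

/-- **THE SUPPORT**: `χ(p) = 0` if `⅞M_c ≤ |p_μ − ctr_μ|` for some `μ`. [cite: Balaban1983RegularityDecay, §2 p.577] -/
theorem chiR_eq_zero (hMc : 0 < Mc) {p : Fin (d + 1) → ℝ} {μ : Fin (d + 1)} (h : 7 / 8 * Mc ≤ |p μ - ctr μ|) : chiR ctr Mc p = 0 :=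
  thetaCube_eq_zero hMc (μ := μ) (by simpa using h)

/-- `χ(p) ≠ 0` forces `|p_μ − ctr_μ| < ⅞M_c` for every `μ`. [cite: Balaban1983RegularityDecay, §2 p.577] -/
theorem near_of_chiR_ne_zero (hMc : 0 < Mc) {p : Fin (d + 1) → ℝ} (h : chiR ctr Mc p ≠ 0) : ∀ μ, |p μ - ctr μ| < 7 / 8 * Mc := by
  intro μ
  by_contra hge
  exact h (chiR_eq_zero ctr hMc (not_lt.1 hge))

/-- `χ(p) ≠ 1` forces `¾M_c < |p_μ − ctr_μ|` for some `μ`. [cite: Balaban1983RegularityDecay, §2 p.577] -/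
theorem far_of_chiR_ne_one (hMc : 0 < Mc) {p : Fin (d + 1) → ℝ} (h : chiR ctr Mc p ≠ 1) : ∃ μ, 3 / 4 * Mc < |p μ - ctr μ| := by
  by_contra hall
  push Not at hall
  exact h (chiR_eq_one ctr hMc hall)

/-- recentring commutes with a move along an axis. [folklore] -/
private theorem update_sub_ctr (p : Fin (d + 1) → ℝ) (μ : Fin (d + 1)) (v : ℝ) :
    (fun ν => Function.update p μ v ν - ctr ν) = Function.update (fun ν => p ν - ctr ν) μ (v - ctr μ) := by
  funext ν
  by_cases h : ν = μ
  · subst h; simp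
  · simp [Function.update_of_ne h]

/-- **FIRST DIFFERENCES ALONG AN AXIS**: `|χ(p + ηe_μ) − χ(p)| ≤ D₁(θ)·|η|/M_c`. [cite: Balaban1983RegularityDecay, §2 p.577 («|∂^ηh_j| ≤ O(M⁻¹)»)] -/
theorem abs_chiR_axis_diff_le (hMc : 0 < Mc) (p : Fin (d + 1) → ℝ) (μ : Fin (d + 1)) (η : ℝ) :
    |chiR ctr Mc (Function.update p μ (p μ + η)) - chiR ctr Mc p| ≤ D1 thetaProf * |η| / Mc := by
  unfold chiR
  rw [update_sub_ctr]
  have e : p μ + η - ctr μ = (fun ν => p ν - ctr ν) μ + η := by simp only; ring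
  rw [e]
  exact abs_thetaCube_diff_le hMc 0 _ μ η

/-- **SECOND DIFFERENCES ALONG AN AXIS**: `|χ(p + ηe_μ) − 2χ(p) + χ(p − ηe_μ)| ≤ D₂(θ)·η²/M_c²`. [cite: Balaban1983RegularityDecay, §2 p.577 («|Δ^ηh_j| ≤ O(M⁻²)»)] -/
theorem abs_chiR_axis_second_diff_le (p : Fin (d + 1) → ℝ) (μ : Fin (d + 1)) (η : ℝ) :
    |chiR ctr Mc (Function.update p μ (p μ + η)) - 2 * chiR ctr Mc p + chiR ctr Mc (Function.update p μ (p μ - η))|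
      ≤ D2 thetaProf * η ^ 2 / Mc ^ 2 := by
  unfold chiR
  rw [update_sub_ctr, update_sub_ctr]
  have e1 : p μ + η - ctr μ = (fun ν => p ν - ctr ν) μ + η := by simp only; ring
  have e2 : p μ - η - ctr μ = (fun ν => p ν - ctr ν) μ - η := by simp only; ring
  rw [e1, e2]
  exact abs_thetaCube_second_diff_le Mc 0 _ μ η

/-- products of `[0, 1]`-valued factors: `|Πa − Πb| ≤ Σ|a − b|`. [folklore] -/
private theorem abs_prod_sub_prod_le_sum {ι : Type*} (s : Finset ι) {a b : ι → ℝ}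
    (ha0 : ∀ i ∈ s, 0 ≤ a i) (ha1 : ∀ i ∈ s, a i ≤ 1) (hb0 : ∀ i ∈ s, 0 ≤ b i) (hb1 : ∀ i ∈ s, b i ≤ 1) :
    |∏ i ∈ s, a i - ∏ i ∈ s, b i| ≤ ∑ i ∈ s, |a i - b i| := by
  classical
  induction s using Finset.induction_on with
  | empty => simp
  | insert j s hj ih =>
    have ih' := ih (fun i hi => ha0 i (Finset.mem_insert_of_mem hi)) (fun i hi => ha1 i (Finset.mem_insert_of_mem hi))
      (fun i hi => hb0 i (Finset.mem_insert_of_mem hi)) (fun i hi => hb1 i (Finset.mem_insert_of_mem hi))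
    have haj0 := ha0 j (Finset.mem_insert_self _ _)
    have haj1 := ha1 j (Finset.mem_insert_self _ _)
    have hB0 : 0 ≤ ∏ i ∈ s, b i := Finset.prod_nonneg fun i hi => hb0 i (Finset.mem_insert_of_mem hi)
    have hB1 : ∏ i ∈ s, b i ≤ 1 :=
      Finset.prod_le_one (fun i hi => hb0 i (Finset.mem_insert_of_mem hi)) fun i hi => hb1 i (Finset.mem_insert_of_mem hi)
    rw [Finset.prod_insert hj, Finset.prod_insert hj, Finset.sum_insert hj]
    have e : a j * ∏ i ∈ s, a i - b j * ∏ i ∈ s, b i =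
        a j * (∏ i ∈ s, a i - ∏ i ∈ s, b i) + (a j - b j) * ∏ i ∈ s, b i := by ring
    rw [e]
    calc |a j * (∏ i ∈ s, a i - ∏ i ∈ s, b i) + (a j - b j) * ∏ i ∈ s, b i|
        ≤ |a j * (∏ i ∈ s, a i - ∏ i ∈ s, b i)| + |(a j - b j) * ∏ i ∈ s, b i| := abs_add_le _ _
      _ = a j * |∏ i ∈ s, a i - ∏ i ∈ s, b i| + |a j - b j| * ∏ i ∈ s, b i := by
          rw [abs_mul, abs_mul, abs_of_nonneg haj0, abs_of_nonneg hB0]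
      _ ≤ 1 * |∏ i ∈ s, a i - ∏ i ∈ s, b i| + |a j - b j| * 1 := by
          have := abs_nonneg (∏ i ∈ s, a i - ∏ i ∈ s, b i)
          have := abs_nonneg (a j - b j)
          nlinarith
      _ ≤ |a j - b j| + ∑ i ∈ s, |a i - b i| := by linarith

/-- **THE SUP-NORM LIPSCHITZ BOUND**: `|χ(p) − χ(q)| ≤ (d+1)·D₁(θ)/M_c·|p − q|_∞`. [cite: Balaban1983RegularityDecay, §2 p.577 («|∂^ηh_j| ≤ O(M⁻¹)»); bookkeeping ours] -/
theorem abs_chiR_sub_le (hMc : 0 < Mc) (p q : Fin (d + 1) → ℝ) :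
    |chiR ctr Mc p - chiR ctr Mc q| ≤ ((d : ℝ) + 1) * D1 thetaProf / Mc * dist p q := by
  have hD1 := D1_nonneg contDiff_thetaProf hasCompactSupport_thetaProf
  rw [chiR_eq, chiR_eq]
  calc |∏ μ, thetaProf ((p μ - ctr μ) / Mc) - ∏ μ, thetaProf ((q μ - ctr μ) / Mc)|
      ≤ ∑ μ, |thetaProf ((p μ - ctr μ) / Mc) - thetaProf ((q μ - ctr μ) / Mc)| :=
        abs_prod_sub_prod_le_sum _ (fun _ _ => thetaProf_nonneg _) (fun _ _ => thetaProf_le_one _)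
          (fun _ _ => thetaProf_nonneg _) fun _ _ => thetaProf_le_one _
    _ ≤ ∑ _μ : Fin (d + 1), D1 thetaProf * (dist p q / Mc) := by
        refine Finset.sum_le_sum fun μ _ => ?_
        have h1 := abs_sub_le_D1 contDiff_thetaProf hasCompactSupport_thetaProf ((q μ - ctr μ) / Mc) ((p μ - ctr μ) / Mc)
        refine h1.trans (mul_le_mul_of_nonneg_left ?_ hD1)
        rw [← sub_div, abs_div, abs_of_pos hMc, show p μ - ctr μ - (q μ - ctr μ) = p μ - q μ by ring]
        have := dist_le_pi_dist p q μ
        rw [Real.dist_eq] at this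
        exact div_le_div_of_nonneg_right this hMc.le
    _ = ((d : ℝ) + 1) * D1 thetaProf / Mc * dist p q := by
        rw [Finset.sum_const, Finset.card_univ, Fintype.card_fin, nsmul_eq_mul]; push_cast; ring

end Real

/-! ## §2  The cut-off on the sites of the V1 torus: labels, genuine lattice steps near the support, the sizes -/

section Sites

variable {ℓ : ℕ} {hd : 1 ≤ d + 1} {hL : Odd (ℓ + 1) ∧ 1 < ℓ + 1} {m K : ℕ}

/-- the labels of a site as a point of `ℝ^{d+1}`. [cite: Balaban1984PropagatorsII, (2.1) p.224, dictionary] -/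
def lab (x : Site (PV d ℓ m K hd hL) 0) : Fin (d + 1) → ℝ := fun μ => (((x μ).val : ℕ) : ℝ)

/-- unfolding. [cite: Balaban1984PropagatorsII, (2.1) p.224, dictionary] -/
@[simp] theorem lab_apply (x : Site (PV d ℓ m K hd hL) 0) (μ : Fin (d + 1)) : lab x μ = (((x μ).val : ℕ) : ℝ) := rfl

/-- the labels are p21's box point read in `ℝ^{d+1}`. [cite: Balaban1984PropagatorsII, (2.1) p.224, dictionary] -/
theorem lab_eq_toR {Mh k : ℕ} {P' : Fin (d + 1) → ℕ} (hN : ∀ μ, N0 ℓ Mh k P' μ = (PV d ℓ m K hd hL).sitesPerDir 0) (x : Site (PV d ℓ m K hd hL) 0) :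
    lab x = toR (toBox hN x).1 := by
  funext μ; simp [toR, toBox_apply]

/-- **THE CUT-OFF `χ_□` ON THE V1 SITES**: `χ(x) = Π_μ θ((val x_μ − ctr_μ)/M_c)`. [cite: Balaban1984PropagatorsII, p.238 (the domain change of line 3 of (2.92)); Balaban1983RegularityDecay, §2 p.577] -/
def chiS (ctr : Fin (d + 1) → ℝ) (Mc : ℝ) (x : Site (PV d ℓ m K hd hL) 0) : ℝ := chiR ctr Mc (lab x)

variable (ctr : Fin (d + 1) → ℝ) {Mc : ℝ}

/-- `0 ≤ χ` (`hχ0`). [cite: Balaban1983RegularityDecay, §2 p.577] -/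
theorem chiS_nonneg (Mc : ℝ) (x : Site (PV d ℓ m K hd hL) 0) : 0 ≤ chiS ctr Mc x := chiR_nonneg ctr Mc _

/-- `χ ≤ 1` (`hχ1`). [cite: Balaban1983RegularityDecay, §2 p.577] -/
theorem chiS_le_one (Mc : ℝ) (x : Site (PV d ℓ m K hd hL) 0) : chiS ctr Mc x ≤ 1 := chiR_le_one ctr Mc _

/-- the plateau on sites. [cite: Balaban1983RegularityDecay, §2 p.577] -/
theorem chiS_eq_one (hMc : 0 < Mc) {x : Site (PV d ℓ m K hd hL) 0} (h : ∀ μ, |lab x μ - ctr μ| ≤ 3 / 4 * Mc) : chiS ctr Mc x = 1 :=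
  chiR_eq_one ctr hMc h

/-! ### Private site arithmetic (the tree's versions in `LatticeFieldCalculus` are private) -/

/-- `(x + e_μ)_μ = x_μ + 1`. [folklore] -/
private theorem shift_apply_self' {P : Params} {j : ℕ} (x : Site P j) (μ : Fin P.d) : x.shift μ μ = x μ + 1 := by
  simp [Site.shift]

/-- `(x + e_μ)_ν = x_ν`, `ν ≠ μ`. [folklore] -/
private theorem shift_apply_ne' {P : Params} {j : ℕ} (x : Site P j) {μ ν : Fin P.d} (h : ν ≠ μ) : x.shift μ ν = x ν := by
  simp [Site.shift, Function.update_of_ne h]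

/-- `(x − e_μ)_μ = x_μ − 1`. [folklore] -/
private theorem unshift_apply_self' {P : Params} {j : ℕ} (x : Site P j) (μ : Fin P.d) : x.unshift μ μ = x μ - 1 := by
  simp [Site.unshift]

/-- `(x − e_μ)_ν = x_ν`, `ν ≠ μ`. [folklore] -/
private theorem unshift_apply_ne' {P : Params} {j : ℕ} (x : Site P j) {μ ν : Fin P.d} (h : ν ≠ μ) : x.unshift μ ν = x ν := by
  simp [Site.unshift, Function.update_of_ne h]

/-- `(x + e_μ) − e_μ = x`. [folklore] -/
private theorem unshift_shift' {P : Params} {j : ℕ} (x : Site P j) (μ : Fin P.d) : (x.shift μ).unshift μ = x := by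
  funext ν
  by_cases h : ν = μ
  · subst h; rw [unshift_apply_self', shift_apply_self']; ring
  · rw [unshift_apply_ne' _ h, shift_apply_ne' _ h]

/-- `(x − e_μ) + e_μ = x`. [folklore] -/
private theorem shift_unshift' {P : Params} {j : ℕ} (x : Site P j) (μ : Fin P.d) : (x.unshift μ).shift μ = x := by
  funext ν
  by_cases h : ν = μ
  · subst h; rw [shift_apply_self', unshift_apply_self']; ring
  · rw [shift_apply_ne' _ h, unshift_apply_ne' _ h]

/-- a genuine step `+e_μ` moves the labels by `e_μ`. [cite: Balaban1984PropagatorsII, (2.7) p.224, dictionary] -/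
theorem lab_shift {x : Site (PV d ℓ m K hd hL) 0} {μ : Fin (d + 1)} (hv : ((x.shift μ) μ).val = (x μ).val + 1) :
    lab (x.shift μ) = Function.update (lab x) μ (lab x μ + 1) := by
  funext ν
  by_cases h : ν = μ
  · subst h; rw [Function.update_self, lab_apply, lab_apply, hv]; push_cast; ring
  · rw [Function.update_of_ne h, lab_apply, lab_apply, shift_apply_ne' x h]

/-- a genuine step `−e_μ` moves the labels by `−e_μ`. [cite: Balaban1984PropagatorsII, (2.8) p.224, dictionary] -/
theorem lab_unshift {x : Site (PV d ℓ m K hd hL) 0} {μ : Fin (d + 1)} (hv : ((x.unshift μ) μ).val + 1 = (x μ).val) :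
    lab (x.unshift μ) = Function.update (lab x) μ (lab x μ - 1) := by
  funext ν
  by_cases h : ν = μ
  · subst h
    simp only [lab, Function.update_self]
    have : (((x ν).val : ℕ) : ℝ) = (((x.unshift ν) ν).val : ℕ) + 1 := by exact_mod_cast hv.symm
    linarith
  · rw [Function.update_of_ne h, lab_apply, lab_apply, unshift_apply_ne' x h]

/-! ### The window, the near region of the support -/

open B6Prop25TwoScaleCensus (TSIdx)

variable {a₀ a₁ : ℝ} {t : TSIdx d (ℓ + 1) hd hL a₀ a₁} {x₀ : Fin (d + 1) → ℤ}
variable (hx₀ : ∀ μ, 0 ≤ x₀ μ) (hfit : ∀ μ, x₀ μ + (t.P.sitesPerDir 0 : ℕ) ≤ ((PV d ℓ m K hd hL).sitesPerDir 0 : ℕ))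
variable (hlo : ∀ μ, (x₀ μ : ℝ) + (7 / 8 * Mc + 3) ≤ ctr μ) (hhi : ∀ μ, ctr μ + (7 / 8 * Mc + 3) ≤ (x₀ μ : ℝ) + (t.P.sitesPerDir 0 : ℕ))

variable (Mc) in
/-- **THE NEAR REGION `|val x − ctr|_∞ < ⅞M_c + r`** (`r = 0`: contains `supp χ`; `r ≤ 3`: inside the window). [cite: Balaban1984PropagatorsII, p.238 (□ ⊂ □̃ ⊂ □̃² ⊂ □̃³), dictionary] -/
def NearS (r : ℝ) (x : Site (PV d ℓ m K hd hL) 0) : Prop := ∀ μ, |lab x μ - ctr μ| < 7 / 8 * Mc + r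

/-- monotonicity of the near regions. [cite: Balaban1984PropagatorsII, p.238, bookkeeping] -/
theorem nearS_mono {r r' : ℝ} (h : r ≤ r') {x : Site (PV d ℓ m K hd hL) 0} (hx : NearS ctr Mc r x) : NearS ctr Mc r' x :=
  fun μ => lt_of_lt_of_le (hx μ) (by linarith)

/-- `supp χ` is near (`r = 0`). [cite: Balaban1983RegularityDecay, §2 p.577] -/
theorem near_of_chiS_ne_zero (hMc : 0 < Mc) {x : Site (PV d ℓ m K hd hL) 0} (h : chiS ctr Mc x ≠ 0) : NearS ctr Mc 0 x :=
  fun μ => by rw [add_zero]; exact near_of_chiR_ne_zero ctr hMc h μ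

/-- `χ = 0` off the near region `r = 1` (indeed off `r = 0`). [cite: Balaban1983RegularityDecay, §2 p.577] -/
theorem chiS_eq_zero_of_not_near (hMc : 0 < Mc) {x : Site (PV d ℓ m K hd hL) 0} (h : ¬ NearS ctr Mc 1 x) : chiS ctr Mc x = 0 := by
  by_contra hne
  exact h (nearS_mono ctr (by norm_num) (near_of_chiS_ne_zero ctr hMc hne))

include hlo hhi in
/-- **THE NEAR REGIONS ARE DEEP IN THE WINDOW**: `NearS r ⊂ DeepS n` for `r + n ≤ 3`. [cite: Balaban1984PropagatorsII, p.238 (□̃³ and the margins of □̃), dictionary] -/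
theorem deep_of_near {r : ℝ} {n : ℕ} (hrn : r + n ≤ 3) {x : Site (PV d ℓ m K hd hL) 0} (hx : NearS ctr Mc r x) : x ∈ DeepS t x₀ n := by
  intro μ
  have h := hx μ
  rw [abs_lt, lab_apply] at h
  have h1 := hlo μ
  have h2 := hhi μ
  have hlo' : ((x₀ μ + n : ℤ) : ℝ) < ((((x μ).val : ℕ) : ℤ) : ℝ) := by push_cast; linarith [h.1]
  have hhi' : ((((x μ).val : ℕ) : ℤ) + n : ℝ) < ((x₀ μ + (t.P.sitesPerDir 0 : ℕ) : ℤ) : ℝ) := by push_cast; linarith [h.2]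
  have a := Int.cast_lt.1 hlo'
  have b : (((x μ).val : ℕ) : ℤ) + n < x₀ μ + (t.P.sitesPerDir 0 : ℕ) := by exact_mod_cast hhi'
  constructor <;> omega

include hfit hlo hhi in
/-- **A STEP `+e_μ` FROM A NEAR SITE IS GENUINE** (`r ≤ 2`): labels move by `e_μ`, the new site is near with `r + 1`. [cite: Balaban1984PropagatorsII, p.238–239 (operators on T_□ «as in (2.19)»), dictionary] -/
theorem shift_near {r : ℝ} (hr : r ≤ 2) {x : Site (PV d ℓ m K hd hL) 0} (hx : NearS ctr Mc r x) (μ : Fin (d + 1)) :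
    NearS ctr Mc (r + 1) (x.shift μ) ∧ lab (x.shift μ) = Function.update (lab x) μ (lab x μ + 1) := by
  have hdeep : x ∈ DeepS t x₀ (0 + 1) := deep_of_near ctr hlo hhi (n := 0 + 1) (by push_cast; linarith) hx
  have hv := (shift_mem_deepS hfit hdeep μ).2
  have hlab := lab_shift hv
  refine ⟨fun ν => ?_, hlab⟩
  rw [hlab]
  by_cases h : ν = μ
  · subst h
    rw [Function.update_self]
    have := hx ν
    calc |lab x ν + 1 - ctr ν| = |(lab x ν - ctr ν) + 1| := by ring_nf
      _ ≤ |lab x ν - ctr ν| + |(1 : ℝ)| := abs_add_le _ _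
      _ < 7 / 8 * Mc + r + 1 := by rw [abs_one]; linarith
      _ = 7 / 8 * Mc + (r + 1) := by ring
  · rw [Function.update_of_ne h]
    have := hx ν
    linarith

include hx₀ hlo hhi in
/-- **A STEP `−e_μ` FROM A NEAR SITE IS GENUINE** (`r ≤ 2`). [cite: Balaban1984PropagatorsII, p.238–239, dictionary] -/
theorem unshift_near {r : ℝ} (hr : r ≤ 2) {x : Site (PV d ℓ m K hd hL) 0} (hx : NearS ctr Mc r x) (μ : Fin (d + 1)) :
    NearS ctr Mc (r + 1) (x.unshift μ) ∧ lab (x.unshift μ) = Function.update (lab x) μ (lab x μ - 1) := by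
  have hdeep : x ∈ DeepS t x₀ (0 + 1) := deep_of_near ctr hlo hhi (n := 0 + 1) (by push_cast; linarith) hx
  have hv := (unshift_mem_deepS hx₀ hdeep μ).2
  have hlab := lab_unshift hv
  refine ⟨fun ν => ?_, hlab⟩
  rw [hlab]
  by_cases h : ν = μ
  · subst h
    rw [Function.update_self]
    have := hx ν
    calc |lab x ν - 1 - ctr ν| = |(lab x ν - ctr ν) + (-1)| := by ring_nf
      _ ≤ |lab x ν - ctr ν| + |(-1 : ℝ)| := abs_add_le _ _
      _ < 7 / 8 * Mc + r + 1 := by rw [abs_neg, abs_one]; linarith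
      _ = 7 / 8 * Mc + (r + 1) := by ring
  · rw [Function.update_of_ne h]
    have := hx ν
    linarith

include hx₀ hfit hlo hhi in
/-- off the near region `r = 1`, `χ` vanishes at the site AND at its lattice neighbours. [cite: Balaban1983RegularityDecay, §2 p.577; bookkeeping] -/
theorem chiS_shift_eq_zero_of_not_near (hMc : 0 < Mc) {x : Site (PV d ℓ m K hd hL) 0} (h : ¬ NearS ctr Mc 1 x) (μ : Fin (d + 1)) :
    chiS ctr Mc (x.shift μ) = 0 ∧ chiS ctr Mc (x.unshift μ) = 0 := by
  constructor
  · by_contra hne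
    have hn := near_of_chiS_ne_zero ctr hMc hne
    have key := (unshift_near ctr hx₀ hlo hhi (r := 0) (by norm_num) hn μ).1
    rw [unshift_shift', zero_add] at key
    exact h key
  · by_contra hne
    have hn := near_of_chiS_ne_zero ctr hMc hne
    have key := (shift_near ctr hfit hlo hhi (r := 0) (by norm_num) hn μ).1
    rw [shift_unshift', zero_add] at key
    exact h key

/-! ### The hypotheses `hχ3`, `hχjump` of `line3_window` -/

include hlo hhi in
/-- **`hχ3`**: `supp χ ⊂ DeepS 3`. [cite: Balaban1984PropagatorsII, p.238 (□̃ inside □̃³ with margins)] -/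
theorem chiS_deep (hMc : 0 < Mc) {x : Site (PV d ℓ m K hd hL) 0} (h : chiS ctr Mc x ≠ 0) : x ∈ DeepS t x₀ 3 :=
  deep_of_near ctr hlo hhi (r := 0) (n := 3) (by norm_num) (near_of_chiS_ne_zero ctr hMc h)

include hx₀ hfit hlo hhi in
/-- **`hχjump`**: a bond across which `χ` jumps starts in `DeepS 1`. [cite: Balaban1984PropagatorsII, p.238, bookkeeping] -/
theorem chiS_jump (hMc : 0 < Mc) (b : PBond (PV d ℓ m K hd hL) 0) (h : chiS ctr Mc b.tgt ≠ chiS ctr Mc b.src) : b.src ∈ DeepS t x₀ 1 := by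
  by_cases hn : NearS ctr Mc 1 b.src
  · exact deep_of_near ctr hlo hhi (r := 1) (n := 1) (by norm_num) hn
  · exfalso
    apply h
    rw [chiS_eq_zero_of_not_near ctr hMc hn]
    exact (chiS_shift_eq_zero_of_not_near ctr hx₀ hfit hlo hhi hMc hn b.dir).1

/-! ### The sizes `hd1`, `hd1'`, `hd2`, `hdb` with CONSTANTS, given that the blocks near the support have side `≤ M_c` -/

variable {Mh k R : ℕ} {P' : Fin (d + 1) → ℕ}
variable (hN : ∀ μ, N0 ℓ Mh k P' μ = (PV d ℓ m K hd hL).sitesPerDir 0) (D : TDomains d ℓ Mh k P' R)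
variable (hwin : ∀ x : Site (PV d ℓ m K hd hL) 0, NearS ctr Mc 3 x → (geomTB D).len (blkS hN D x) ≤ Mc)

/-- `D₁(θ) ≥ 0`. [cite: Balaban1983RegularityDecay, §2 p.577] -/
theorem D1_thetaProf_nonneg : 0 ≤ D1 thetaProf := D1_nonneg contDiff_thetaProf hasCompactSupport_thetaProf

/-- `D₂(θ) ≥ 0`. [cite: Balaban1983RegularityDecay, §2 p.577] -/
theorem D2_thetaProf_nonneg : 0 ≤ D2 thetaProf := D2_nonneg contDiff_thetaProf hasCompactSupport_thetaProf

omit hwin in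
/-- block lengths are nonnegative. [cite: Balaban1984PropagatorsII, (2.1) p.224, dictionary] -/
theorem len_blkS_nonneg (x : Site (PV d ℓ m K hd hL) 0) : 0 ≤ (geomTB D).len (blkS hN D x) := by
  rw [geomTB_len]; positivity

include hx₀ hfit hlo hhi hwin in
/-- **`hd1`**: `|χ(b₊) − χ(b₋)|·len(y(b)) ≤ D₁(θ)` for every bond `b`. [cite: Balaban1983RegularityDecay, §2 p.577 («|∂^ηh_j| ≤ O(M⁻¹)»); Balaban1984PropagatorsII, p.238] -/
theorem hd1_chiS (hMc : 0 < Mc) (b : PBond (PV d ℓ m K hd hL) 0) :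
    |chiS ctr Mc b.tgt - chiS ctr Mc b.src| * (geomTB D).len (blkV1 hN D b) ≤ D1 thetaProf := by
  rw [blkV1_eq_blkS]
  by_cases hn : NearS ctr Mc 1 b.src
  · obtain ⟨-, hlab⟩ := shift_near ctr hfit hlo hhi (r := 1) (by norm_num) hn b.dir
    have hdiff : |chiS ctr Mc b.tgt - chiS ctr Mc b.src| ≤ D1 thetaProf * |(1 : ℝ)| / Mc := by
      show |chiR ctr Mc (lab (b.src.shift b.dir)) - chiR ctr Mc (lab b.src)| ≤ _
      rw [hlab]
      exact abs_chiR_axis_diff_le ctr hMc (lab b.src) b.dir 1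
    rw [abs_one, mul_one] at hdiff
    have hlen := hwin b.src (nearS_mono ctr (by norm_num) hn)
    calc |chiS ctr Mc b.tgt - chiS ctr Mc b.src| * (geomTB D).len (blkS hN D b.src)
        ≤ D1 thetaProf / Mc * Mc := mul_le_mul hdiff hlen (len_blkS_nonneg hN D _) (div_nonneg D1_thetaProf_nonneg hMc.le)
      _ = D1 thetaProf := by field_simp
  · rw [chiS_eq_zero_of_not_near ctr hMc hn, show b.tgt = b.src.shift b.dir from rfl,
      (chiS_shift_eq_zero_of_not_near ctr hx₀ hfit hlo hhi hMc hn b.dir).1, sub_zero, abs_zero, zero_mul]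
    exact D1_thetaProf_nonneg

include hx₀ hfit hlo hhi hwin in
/-- **`hd1'`**: `|χ(x) − χ(x ∓ e_μ)|·len(y(x)) ≤ D₁(θ)` (p22's `shInv`). [cite: Balaban1983RegularityDecay, §2 p.577; Balaban1984PropagatorsII, p.238] -/
theorem hd1'_chiS (hMc : 0 < Mc) (e : Fin (d + 1) × Bool) (x : Site (PV d ℓ m K hd hL) 0) :
    |chiS ctr Mc x - chiS ctr Mc (shInv e x)| * (geomTB D).len (blkS hN D x) ≤ D1 thetaProf := by
  obtain ⟨μ, bb⟩ := e
  by_cases hn : NearS ctr Mc 1 x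
  · have hlen := hwin x (nearS_mono ctr (by norm_num) hn)
    have hdiff : |chiS ctr Mc x - chiS ctr Mc (shInv (μ, bb) x)| ≤ D1 thetaProf / Mc := by
      cases bb
      · rw [shInv_ff, abs_sub_comm]
        obtain ⟨-, hlab⟩ := shift_near ctr hfit hlo hhi (r := 1) (by norm_num) hn μ
        show |chiR ctr Mc (lab (x.shift μ)) - chiR ctr Mc (lab x)| ≤ _
        rw [hlab]
        have h := abs_chiR_axis_diff_le ctr hMc (lab x) μ 1
        rwa [abs_one, mul_one] at h
      · rw [shInv_tt, abs_sub_comm]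
        obtain ⟨-, hlab⟩ := unshift_near ctr hx₀ hlo hhi (r := 1) (by norm_num) hn μ
        show |chiR ctr Mc (lab (x.unshift μ)) - chiR ctr Mc (lab x)| ≤ _
        rw [hlab, show lab x μ - 1 = lab x μ + (-1) by ring]
        have h := abs_chiR_axis_diff_le ctr hMc (lab x) μ (-1)
        rwa [abs_neg, abs_one, mul_one] at h
    calc |chiS ctr Mc x - chiS ctr Mc (shInv (μ, bb) x)| * (geomTB D).len (blkS hN D x)
        ≤ D1 thetaProf / Mc * Mc := mul_le_mul hdiff hlen (len_blkS_nonneg hN D _) (div_nonneg D1_thetaProf_nonneg hMc.le)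
      _ = D1 thetaProf := by field_simp
  · have h0 := chiS_shift_eq_zero_of_not_near ctr hx₀ hfit hlo hhi hMc hn μ
    rw [chiS_eq_zero_of_not_near ctr hMc hn]
    cases bb
    · rw [shInv_ff, h0.1, sub_zero, abs_zero, zero_mul]; exact D1_thetaProf_nonneg
    · rw [shInv_tt, h0.2, sub_zero, abs_zero, zero_mul]; exact D1_thetaProf_nonneg

include hx₀ hfit hlo hhi hwin in
/-- **`hd2`**: `|χ(y + e_μ) − 2χ(y) + χ(y − e_μ)|·len(y(y))² ≤ D₂(θ)`. [cite: Balaban1983RegularityDecay, §2 p.577 («|Δ^ηh_j| ≤ O(M⁻²)»); Balaban1984PropagatorsII, p.238] -/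
theorem hd2_chiS (hMc : 0 < Mc) (y : Site (PV d ℓ m K hd hL) 0) (μ : Fin (d + 1)) :
    |chiS ctr Mc (y.shift μ) - 2 * chiS ctr Mc y + chiS ctr Mc (y.unshift μ)| * (geomTB D).len (blkS hN D y) ^ 2 ≤ D2 thetaProf := by
  by_cases hn : NearS ctr Mc 1 y
  · have hlen := hwin y (nearS_mono ctr (by norm_num) hn)
    obtain ⟨-, hlab1⟩ := shift_near ctr hfit hlo hhi (r := 1) (by norm_num) hn μ
    obtain ⟨-, hlab2⟩ := unshift_near ctr hx₀ hlo hhi (r := 1) (by norm_num) hn μ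
    have hdiff : |chiS ctr Mc (y.shift μ) - 2 * chiS ctr Mc y + chiS ctr Mc (y.unshift μ)| ≤ D2 thetaProf / Mc ^ 2 := by
      show |chiR ctr Mc (lab (y.shift μ)) - 2 * chiR ctr Mc (lab y) + chiR ctr Mc (lab (y.unshift μ))| ≤ _
      rw [hlab1, hlab2]
      have h := abs_chiR_axis_second_diff_le ctr (Mc := Mc) (lab y) μ 1
      rwa [one_pow, mul_one] at h
    have hl0 := len_blkS_nonneg hN D y
    calc |chiS ctr Mc (y.shift μ) - 2 * chiS ctr Mc y + chiS ctr Mc (y.unshift μ)| * (geomTB D).len (blkS hN D y) ^ 2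
        ≤ D2 thetaProf / Mc ^ 2 * Mc ^ 2 :=
          mul_le_mul hdiff (pow_le_pow_left₀ hl0 hlen 2) (by positivity) (div_nonneg D2_thetaProf_nonneg (by positivity))
      _ = D2 thetaProf := by field_simp
  · have h0 := chiS_shift_eq_zero_of_not_near ctr hx₀ hfit hlo hhi hMc hn μ
    rw [chiS_eq_zero_of_not_near ctr hMc hn, h0.1, h0.2]
    norm_num
    exact D2_thetaProf_nonneg

omit hwin in
/-- labels of two sites of one block differ by less than the side. [cite: Balaban1984PropagatorsII, (2.1) p.224, dictionary] -/
theorem dist_lab_le_of_blkS_eq {x y : Site (PV d ℓ m K hd hL) 0} (h : blkS hN D x = blkS hN D y) :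
    dist (lab x) (lab y) ≤ (geomTB D).len (blkS hN D x) - 1 := by
  have hL1 : (1 : ℝ) ≤ (geomTB D).len (blkS hN D x) := by
    rw [geomTB_len, mul_one]; exact one_le_pow₀ (by linarith [(Nat.cast_nonneg ℓ : (0 : ℝ) ≤ ℓ)])
  refine (dist_pi_le_iff (by linarith)).2 fun μ => ?_
  rw [Real.dist_eq]
  have key := abs_sub_le_of_blkOf_eq D.toDomains (rfl : blkOf D.toDomains (toBox hN x) = blkS hN D x) h.symm μ
  rw [geomTB_len, mul_one]
  have e1 : lab x μ = ((toBox hN x).1 μ : ℝ) := by simp [toBox_apply]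
  have e2 : lab y μ = ((toBox hN y).1 μ : ℝ) := by simp [toBox_apply]
  rw [e1, e2]
  have e3 : ((((ℓ + 1) ^ (blkS hN D x).1.1 : ℕ) : ℝ)) = ((ℓ : ℝ) + 1) ^ (blkS hN D x).1.1 := by push_cast; ring
  rw [← e3]; exact key

include hwin in
/-- **`hdb`**: the oscillation of `χ` over a block is `≤ (d+1)D₁(θ)`. [cite: Balaban1983RegularityDecay, §2 p.577; Balaban1984PropagatorsII, p.238] -/
theorem hdb_chiS (hMc : 0 < Mc) (x y : Site (PV d ℓ m K hd hL) 0) (h : blkS hN D x = blkS hN D y) :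
    |chiS ctr Mc x - chiS ctr Mc y| ≤ ((d : ℝ) + 1) * D1 thetaProf := by
  have hD1 := D1_thetaProf_nonneg
  -- the near case, for either order
  have key : ∀ {x y : Site (PV d ℓ m K hd hL) 0}, blkS hN D x = blkS hN D y → NearS ctr Mc 1 x →
      |chiS ctr Mc x - chiS ctr Mc y| ≤ ((d : ℝ) + 1) * D1 thetaProf := by
    intro x y h hn
    have hlen := hwin x (nearS_mono ctr (by norm_num) hn)
    have hdist : dist (lab x) (lab y) ≤ Mc := by linarith [dist_lab_le_of_blkS_eq hN D h]
    calc |chiS ctr Mc x - chiS ctr Mc y| ≤ ((d : ℝ) + 1) * D1 thetaProf / Mc * dist (lab x) (lab y) := abs_chiR_sub_le ctr hMc _ _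
      _ ≤ ((d : ℝ) + 1) * D1 thetaProf / Mc * Mc := mul_le_mul_of_nonneg_left hdist (by positivity)
      _ = ((d : ℝ) + 1) * D1 thetaProf := by field_simp
  by_cases hx : NearS ctr Mc 1 x
  · exact key h hx
  by_cases hy : NearS ctr Mc 1 y
  · rw [abs_sub_comm]; exact key h.symm hy
  rw [chiS_eq_zero_of_not_near ctr hMc hx, chiS_eq_zero_of_not_near ctr hMc hy, sub_zero, abs_zero]
  positivity

end Sites

/-! ## §3  The zone of a cut-off: the blocks where `χ` or a neighbouring value of `χ` differs from `1` -/

section Zone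

variable {ℓ : ℕ} {hd : 1 ≤ d + 1} {hL : Odd (ℓ + 1) ∧ 1 < ℓ + 1} {m K : ℕ} {Mh k R : ℕ} {P' : Fin (d + 1) → ℕ}
variable (hN : ∀ μ, N0 ℓ Mh k P' μ = (PV d ℓ m K hd hL).sitesPerDir 0) (D : TDomains d ℓ Mh k P' R) (χ : Site (PV d ℓ m K hd hL) 0 → ℝ)

open Classical in
/-- **THE ZONE `N` OF A CUT-OFF `χ`**: the blocks `y ∈ 𝔅` containing a site `x` such that `χ(x) ≠ 1` or `χ(x ± e_μ) ≠ 1` for some `μ` — off `N`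
the cut-off is `1` together with its lattice neighbours (the rows of `[χ, Δ′]` live in `N`). [cite: Balaban1984PropagatorsII, p.238 («the terms with the commutator»), bookkeeping ours] -/
def zoneN : Finset ↥(bset D.toDomains) :=
  Finset.univ.filter fun y => ∃ x : Site (PV d ℓ m K hd hL) 0, blkS hN D x = y ∧ (χ x ≠ 1 ∨ ∃ μ, χ (x.shift μ) ≠ 1 ∨ χ (x.unshift μ) ≠ 1)

open Classical in
/-- membership in the zone. [cite: Balaban1984PropagatorsII, p.238, bookkeeping] -/
theorem mem_zoneN {y : ↥(bset D.toDomains)} :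
    y ∈ zoneN hN D χ ↔ ∃ x : Site (PV d ℓ m K hd hL) 0, blkS hN D x = y ∧ (χ x ≠ 1 ∨ ∃ μ, χ (x.shift μ) ≠ 1 ∨ χ (x.unshift μ) ≠ 1) := by
  unfold zoneN
  rw [Finset.mem_filter]
  exact ⟨fun h => h.2, fun h => ⟨Finset.mem_univ _, h⟩⟩

/-- a block containing a site with `χ ≠ 1` is in the zone. [cite: Balaban1984PropagatorsII, p.238, bookkeeping] -/
theorem blkS_mem_zoneN {x : Site (PV d ℓ m K hd hL) 0} (h : χ x ≠ 1) : blkS hN D x ∈ zoneN hN D χ :=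
  (mem_zoneN hN D χ).2 ⟨x, rfl, Or.inl h⟩

/-- **`hχN`**: off the zone `χ = 1`. [cite: Balaban1984PropagatorsII, p.238, bookkeeping] -/
theorem chi_eq_one_of_not_mem_zoneN (x : Site (PV d ℓ m K hd hL) 0) (h : blkS hN D x ∉ zoneN hN D χ) : χ x = 1 := by
  by_contra hne
  exact h (blkS_mem_zoneN hN D χ hne)

/-- **`hNχ`**: off the zone `χ` is constant under lattice steps and along the block. [cite: Balaban1984PropagatorsII, p.238, bookkeeping] -/
theorem chi_const_of_not_mem_zoneN (y : Site (PV d ℓ m K hd hL) 0) (h : blkS hN D y ∉ zoneN hN D χ) :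
    (∀ μ, χ (y.shift μ) = χ y ∧ χ (y.unshift μ) = χ y) ∧ ∀ x : Site (PV d ℓ m K hd hL) 0, blkS hN D x = blkS hN D y → χ x = χ y := by
  have hy : χ y = 1 := chi_eq_one_of_not_mem_zoneN hN D χ y h
  refine ⟨fun μ => ⟨?_, ?_⟩, fun x hx => ?_⟩
  · by_contra hne
    rw [hy] at hne
    exact h ((mem_zoneN hN D χ).2 ⟨y, rfl, Or.inr ⟨μ, Or.inl hne⟩⟩)
  · by_contra hne
    rw [hy] at hne
    exact h ((mem_zoneN hN D χ).2 ⟨y, rfl, Or.inr ⟨μ, Or.inr hne⟩⟩)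
  · rw [hy]
    by_contra hne
    exact h (hx ▸ blkS_mem_zoneN hN D χ hne)

/-- **`hNne`**: the zone is non-empty as soon as `χ ≠ 1` somewhere. [cite: Balaban1984PropagatorsII, p.238, bookkeeping] -/
theorem zoneN_nonempty {z : Site (PV d ℓ m K hd hL) 0} (h : χ z ≠ 1) : (zoneN hN D χ).Nonempty := ⟨_, blkS_mem_zoneN hN D χ h⟩

end Zone

/-! ## §4  The column cut `c_L` (indicator of the plateau): `hcL` and `hEL` -/

section Column

variable {ℓ : ℕ} {hd : 1 ≤ d + 1} {hL : Odd (ℓ + 1) ∧ 1 < ℓ + 1} {m K : ℕ}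
variable (ctr : Fin (d + 1) → ℝ) (Mc : ℝ)

open Classical in
/-- **THE COLUMN CUT `c_L`**: the indicator of the plateau `|val x − ctr|_∞ ≤ ¾M_c` of `χ`. [cite: Balaban1984PropagatorsII, p.238 (the terms with the commutator), bookkeeping ours] -/
def cL (x : Site (PV d ℓ m K hd hL) 0) : ℝ := if ∀ μ, |lab x μ - ctr μ| ≤ 3 / 4 * Mc then 1 else 0

variable {Mc}

/-- `c_L = 1` on the plateau. [cite: Balaban1984PropagatorsII, p.238, bookkeeping] -/
theorem cL_eq_one {x : Site (PV d ℓ m K hd hL) 0} (h : ∀ μ, |lab x μ - ctr μ| ≤ 3 / 4 * Mc) : cL ctr Mc x = 1 := by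
  unfold cL; rw [if_pos h]

/-- **`hcL`**: `c_L·χ = c_L`. [cite: Balaban1984PropagatorsII, p.238, bookkeeping] -/
theorem cL_mul_chiS (hMc : 0 < Mc) (x : Site (PV d ℓ m K hd hL) 0) : cL ctr Mc x * chiS ctr Mc x = cL ctr Mc x := by
  unfold cL
  split_ifs with h
  · rw [chiS_eq_one ctr hMc h, mul_one]
  · rw [zero_mul]

/-- **`hEL`**: `ζ·∂(c_L f) = ζ·∂f` for every bond cut-off `ζ` whose bonds have both end points on the plateau (the stencil `∂` at a bond reads only
its two end points). [cite: Balaban1984PropagatorsII, (2.7) p.224, p.238; bookkeeping ours] -/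
theorem hEL_cL (cf : ℝ) (ζ : PBond (PV d ℓ m K hd hL) 0 → ℝ)
    (hζ : ∀ b, ζ b ≠ 0 → (∀ μ, |lab b.src μ - ctr μ| ≤ 3 / 4 * Mc) ∧ ∀ μ, |lab b.tgt μ - ctr μ| ≤ 3 / 4 * Mc) :
    (mulOp ζ ∘ₗ onFun (dE (P := PV d ℓ m K hd hL) cf)) ∘ₗ mulOp (cL ctr Mc) = mulOp ζ ∘ₗ onFun (dE (P := PV d ℓ m K hd hL) cf) := by
  apply LinearMap.ext; intro f; funext b
  simp only [LinearMap.comp_apply, mulOp_apply, onFun_apply, B6SectAOperatorsV1.dE_apply, LatticeFieldCalculus.grad, smul_eq_mul]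
  by_cases hb : ζ b = 0
  · rw [hb, zero_mul, zero_mul]
  · obtain ⟨hs, ht⟩ := hζ b hb
    rw [cL_eq_one ctr hs, cL_eq_one ctr ht, one_mul, one_mul]

end Column

/-! ## §5  The zone of `χ_□` lies off the shrunken plateau: every zone block contains a site `x` with `|val x_μ − ctr_μ| > ¾M_c − 1` for some `μ` -/

section ZoneFar

variable {ℓ : ℕ} {hd : 1 ≤ d + 1} {hL : Odd (ℓ + 1) ∧ 1 < ℓ + 1} {m K : ℕ} {Mh k R : ℕ} {P' : Fin (d + 1) → ℕ}
variable (hN : ∀ μ, N0 ℓ Mh k P' μ = (PV d ℓ m K hd hL).sitesPerDir 0) (D : TDomains d ℓ Mh k P' R)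
variable (ctr : Fin (d + 1) → ℝ) {Mc : ℝ}
variable {a₀ a₁ : ℝ} {t : TSIdx d (ℓ + 1) hd hL a₀ a₁} {x₀ : Fin (d + 1) → ℤ}
variable (hx₀ : ∀ μ, 0 ≤ x₀ μ) (hfit : ∀ μ, x₀ μ + (t.P.sitesPerDir 0 : ℕ) ≤ ((PV d ℓ m K hd hL).sitesPerDir 0 : ℕ))
variable (hlo : ∀ μ, (x₀ μ : ℝ) + (7 / 8 * Mc + 3) ≤ ctr μ) (hhi : ∀ μ, ctr μ + (7 / 8 * Mc + 3) ≤ (x₀ μ : ℝ) + (t.P.sitesPerDir 0 : ℕ))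

include hx₀ hfit hlo hhi in
/-- **THE ZONE OF `χ_□` IS FAR FROM THE CENTRE**: a block of `zoneN (χ_□)` contains a site with a label coordinate farther than `¾M_c − 1` from the
centre (a site of the shrunken plateau has `χ = 1` at itself and at all its lattice neighbours). [cite: Balaban1984PropagatorsII, p.238; bookkeeping ours] -/
theorem exists_far_of_mem_zoneN (hMc : 0 < Mc) {y : ↥(bset D.toDomains)} (hy : y ∈ zoneN hN D (chiS ctr Mc)) :
    ∃ x : Site (PV d ℓ m K hd hL) 0, blkS hN D x = y ∧ ∃ μ, 3 / 4 * Mc - 1 < |lab x μ - ctr μ| := by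
  obtain ⟨x, hxy, hcase⟩ := (mem_zoneN hN D (chiS ctr Mc)).1 hy
  refine ⟨x, hxy, ?_⟩
  by_contra hall
  push Not at hall
  have hn : NearS ctr Mc (-(Mc / 8) - 1 / 2) x := fun μ => by have := hall μ; linarith
  have hr : -(Mc / 8) - 1 / 2 ≤ 2 := by linarith
  have hplat : ∀ ν, |lab x ν - ctr ν| ≤ 3 / 4 * Mc := fun ν => by have := hall ν; linarith
  rcases hcase with h | ⟨μ, h | h⟩
  · exact h (chiS_eq_one ctr hMc hplat)
  · obtain ⟨-, hlab⟩ := shift_near ctr hfit hlo hhi hr hn μ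
    apply h
    apply chiS_eq_one ctr hMc
    intro ν
    show |lab (x.shift μ) ν - ctr ν| ≤ 3 / 4 * Mc
    rw [hlab]
    by_cases hν : ν = μ
    · subst hν
      rw [Function.update_self]
      have := hall ν
      calc |lab x ν + 1 - ctr ν| = |(lab x ν - ctr ν) + 1| := by ring_nf
        _ ≤ |lab x ν - ctr ν| + |(1 : ℝ)| := abs_add_le _ _
        _ ≤ 3 / 4 * Mc := by rw [abs_one]; linarith
    · rw [Function.update_of_ne hν]; exact hplat ν
  · obtain ⟨-, hlab⟩ := unshift_near ctr hx₀ hlo hhi hr hn μ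
    apply h
    apply chiS_eq_one ctr hMc
    intro ν
    show |lab (x.unshift μ) ν - ctr ν| ≤ 3 / 4 * Mc
    rw [hlab]
    by_cases hν : ν = μ
    · subst hν
      rw [Function.update_self]
      have := hall ν
      calc |lab x ν - 1 - ctr ν| = |(lab x ν - ctr ν) + (-1)| := by ring_nf
        _ ≤ |lab x ν - ctr ν| + |(-1 : ℝ)| := abs_add_le _ _
        _ ≤ 3 / 4 * Mc := by rw [abs_neg, abs_one]; linarith
    · rw [Function.update_of_ne hν]; exact hplat ν

include hlo in
/-- the window has a site off the support of `χ_□` (its corner block), so the zone is non-empty. [cite: Balaban1984PropagatorsII, p.238, bookkeeping] -/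
theorem chiS_ne_one_of_corner (hMc : 0 < Mc) {x : Site (PV d ℓ m K hd hL) 0} (hx : ∃ μ, ((x μ).val : ℤ) = x₀ μ) : chiS ctr Mc x ≠ 1 := by
  obtain ⟨μ, hμ⟩ := hx
  have h0 : chiS ctr Mc x = 0 := by
    apply chiR_eq_zero ctr hMc (μ := μ)
    have e : lab x μ = (x₀ μ : ℝ) := by rw [lab_apply]; exact_mod_cast hμ
    rw [e, abs_sub_comm, abs_of_nonneg (by linarith [hlo μ])]
    linarith [hlo μ]
  rw [h0]; norm_num

end ZoneFar




end

end Literature.MathematicalPhysics.QuantumFieldTheory.Balaban1983to89.B6Line3CutoffV1
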